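import Summits.QuantumFields.YangMills.Theorems.BalabanUVNodesN07SymAxialTreeDefect
import Summits.QuantumFields.YangMills.Theorems.BalabanUVNodesN07StairFamilyLettersOfBoxPlaquettes
import Summits.QuantumFields.YangMills.Theorems.BalabanUVNodesN07IterPlaquettesOfFineBoxPlaquettes
import HarnessLib

/-!
# N07 [B11] (= [15] = [Balaban1985Variational]) Sect. F ∕ [I] (0.11) — **THE RADIAL TREE-TRANSPORTER DEFECT `δ₁(n)` OF A `symCd`-AXIAL AVERAGED FIELD FROM THE PLAQUETTES OF ITS BLOCK
# BOX, AND FROM THE FINE PLAQUETTES UNDER THE BLOCK** — the torus-side supplier of the junction's (σ2), ASSEMBLED by name: this seat's ✓p754286∕✓p754516∕✓p754873 `…N07SymAxialTreeDefect`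
# ((0.11)-mean half + radial member + gauge-copy transfer) ∘ dag-n07-e's ✓p754897 `…N07StairFamilyLettersOfBoxPlaquettes` (pairwise stair letter + Federbush guard from box plaquettes)
# ∘ dag-n07-e's ✓p755199 `…N07IterPlaquettesOfFineBoxPlaquettes` (the averaged field's box plaquettes from the fine plaquettes under the block)

Cell `pub-ymgap`, width seat `pub-ymgap-dag-n07-w3` g13 (junction side of the K0 road).  `--kind proof --supports stmt-QuantumFields-20541 --as helper` (K0⁷; count-neutral; THEOREMS ONLY,
0 `def`).  [I] = [Balaban1987RG1]; [15] = [Balaban1985Variational]; [3] = [Balaban1985Averaging]; [6] = [Balaban1985RegularSpaces].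
CONSUMED BY NAME: `…N07SymAxialTreeDefect.dist1_radialHol_le_of_axialGauge_symCd`, `…N07StairFamilyLettersOfBoxPlaquettes.{dist1_stairFamily_pairwise_le_of_boxPlaqs,
familySmall_stairFamily_of_boxPlaqs}`, `…N07IterPlaquettesOfFineBoxPlaquettes.plaqSmallOn_iter_block_of_fineBoxPlaqs`, `T4Continuum.iter_gaugeAct` ([3] (11) iterated),
`IterPlaqSmallAllL.dist1_plaqHol_gaugeAct`, `Node00.DatumAvLayer.avOfRecord` (= `blockAvg expMeanLogSU`, `rfl`).

WHY.  The junction's cross term reads the first factor `τ = lift(h̄·w_s)·vfix⁻¹` through its averaged tree-transporter defects (✓p754021): on the radial side `δ₂ ≡ 0` (`InAxOneZ`), on the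
symmetric side `δ₁(n)` = the deviation from `1` of the RADIAL staircase transporter of the `symCd`-axial averaged field `M^n(U^{w_s})` inside a block.  THIS FILE produces that torus-side
letter: (§1) for a `symCd`-axial field `W` at level `m` from the plaquette letter `a` of `W` on the block's box — `dist1 (W(Γ_{y,x})) ≤ 4·(2σ′(a))`, `σ′(a) = d⌊(L−1)∕2⌋·((d−1)(L−1)·a)`
(126's box gauge + Stokes-free bond telescoping, then the (0.11)-mean argument of ✓p754286 at the radial member of ✓p754516); (§2) for `W := M^n(U^w)`, ANY gauge `w`, from the plaquette
letter of `M^n U` on the box ([3] (11): the plaquettes of `M^n(U^w)` are those of `M^n U` conjugated); (§3) from the FINE plaquettes of `U` under the one level-`(n+1)` block (127).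
The region index of the fine letter (`a₀ := ε_r·η_r²` from the def of record's row (17)) and the cover transcription to `ℤᵈ` (g9 ✓`…N07RadialHolCoverLift`, clamped lift, (0.4) guard)
are the knit's.

WHAT IS PROVED (sorry-free).  §1 ★★ `dist1_radialHol_le_of_axialGauge_symCd_of_boxPlaqs`; §2 `plaqSmallOn_iter_gaugeAct_of_plaqSmallOn_iter` (plaquette letter of `M^n(U^w)` = that of
`M^n U`), ★★★ `dist1_radialHol_iter_gaugeAct_le_of_boxPlaqs`; §3 ★★★ `dist1_radialHol_iter_gaugeAct_le_of_fineBoxPlaqs` (from the fine plaquettes under the block, 127's budgets verbatim).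
HONEST FRAMING: count-neutral helper; composition by name of landed bookkeeping files — nothing of [I]∕[15]∕[3]∕[6] asserted or discharged; the `symCd`-axiality of the carrier, the fine
letter's region index and the `ℤᵈ` transcription are INPUTS of the knit; `NrmSymPhiOfRecord` ∕ `HThm4RecSym152PhiE(G)` ∕ `HThm4Rec*` UNDISCHARGED; N05 ∕ N07 NOT discharged; K0⁷ ∕ K1⁹ NOT
closed; counts unmoved (typed 28∕28 · discharged 8∕28); one finite 𝕋⁴ programme at fixed ε — R4 closes the conditional finite-𝕋⁴ rung `BalabanLadder.UV` only; the YM mass gap (Clay)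
is NOT proved by any of this; nothing continuum ∕ ℝ⁴ ∕ OS.  No `def`, no `instance`, no `notation`, no `sorry`.

References: [I] (0.3)–(0.4) pp. 252–253, (0.5)–(0.7), (0.10)–(0.11) p. 253; [15] (147)–(154) pp. 301–302; [3] (11) p. 19; [6] (1.15) p. 78, (1.19) p. 79.
-/

set_option autoImplicit false

noncomputable section

open scoped BigOperators Matrix.Norms.L2Operator

namespace Summit.QuantumFields.YangMills.BalabanUVNodes.N07SymAxialRadialDefectOfBoxPlaquettes

open Literature.MathematicalPhysics.QuantumFieldTheory.Balaban1983to89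
open Literature.MathematicalPhysics.QuantumFieldTheory.Balaban1983to89.Node00
open T4Continuum (T4Family transfUp iter_gaugeAct)
open T4AxialGaugeSmallField (castSite boxPlaqs)
open B14DomainGeom (Pt)
open GaugeField (gaugeAct)
open ExpMeanLog (expMeanLogSU deltaSU)
open BlockAveraging (blockAvg)
open Summit.QuantumFields.Balaban3D.Carriers (radialHol)
open Summit.QuantumFields.YangMills.BalabanUVNodes.N07SymContourData (stairFamily)
open Summit.QuantumFields.YangMills.BalabanUVNodes.N07NormalisationSymOfRecord (symCd)
open Summit.QuantumFields.YangMills.BalabanUVNodes.N07SymAxialTreeDefect (dist1_radialHol_le_of_axialGauge_symCd)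
open Summit.QuantumFields.YangMills.BalabanUVNodes.N07StairFamilyLettersOfBoxPlaquettes (dist1_stairFamily_pairwise_le_of_boxPlaqs familySmall_stairFamily_of_boxPlaqs)
open Summit.QuantumFields.YangMills.BalabanUVNodes.N07IterPlaquettesOfFineBoxPlaquettes (plaqSmallOn_iter_block_of_fineBoxPlaqs)
open Summit.QuantumFields.YangMills.Theorems.IterPlaqSmallAllL (dist1_plaqHol_gaugeAct)

variable {F : T4Family} {N : ℕ} [NeZero N]

/-! ## §1  A `symCd`-axial field: the radial transporter from the box plaquette letter -/

/-- ★★ **THE RADIAL TRANSPORTER OF A `symCd`-AXIAL FIELD FROM THE PLAQUETTES OF ITS BLOCK BOX**: for `W` `symCd`-axial at level `m` (`m + 1 ≤ m_F + K`, `L < sitesPerDir m`), a block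
`y = castSite t` whose box plaquettes are within `a ≥ 0` of `1`, with `2σ′(a) ≤ 1∕100` and `2σ′(a) < δ_N` (`σ′(a) = d⌊(L−1)∕2⌋·((d−1)(L−1)·a)`), and a block site `x = blockSite y r ≠ emb y`:
`dist1 (W(Γ_{y,x})) ≤ 4·(2σ′(a))`. [cite: Balaban1987RG1, (0.3) p.252, (0.11) p.253, (0.5)–(0.7) p.253; Balaban1985Variational, (147) p.301; Balaban1985RegularSpaces, (1.15) p.78] -/
theorem dist1_radialHol_le_of_axialGauge_symCd_of_boxPlaqs {K m : ℕ} (hm : m + 1 ≤ (F.P K).m + (F.P K).K) (W : GaugeField (F.P K) m (SU N))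
    (hax : AxialGauge (symCd F N K m) W) {a : ℝ} (ha : 0 ≤ a) (hN : (F.P K).L < (F.P K).sitesPerDir m) (t : Fin (F.P K).d → ℤ)
    (hplaq : PlaqSmallOn (boxPlaqs (fun i => ((F.P K).L : ℤ) * t i) (fun i => ((F.P K).L : ℤ) * t i + (((F.P K).L : ℤ) - 1))) a W)
    (h100 : 2 * ((((F.P K).d * (((F.P K).L - 1) / 2) : ℕ) : ℝ) * (((((F.P K).d - 1 : ℕ) : ℝ) * (((F.P K).L - 1 : ℕ) : ℝ)) * a)) ≤ 1 / 100)
    (hguard : 2 * ((((F.P K).d * (((F.P K).L - 1) / 2) : ℕ) : ℝ) * (((((F.P K).d - 1 : ℕ) : ℝ) * (((F.P K).L - 1 : ℕ) : ℝ)) * a)) < (FederbushMean.federbushSU (n := Fin N)).δ)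
    (r : Fin (F.P K).d → Fin (F.P K).L) (hxy : Site.blockSite (castSite t : Site (F.P K) (m + 1)) r ≠ emb (castSite t : Site (F.P K) (m + 1))) :
    dist1 (radialHol W (castSite t) (Site.blockSite (castSite t) r)) ≤
      4 * (2 * ((((F.P K).d * (((F.P K).L - 1) / 2) : ℕ) : ℝ) * (((((F.P K).d - 1 : ℕ) : ℝ) * (((F.P K).L - 1 : ℕ) : ℝ)) * a))) :=
  dist1_radialHol_le_of_axialGauge_symCd hm hax (castSite t) r hxy (familySmall_stairFamily_of_boxPlaqs hm W ha hN t hplaq hguard r) h100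
    (fun i => dist1_stairFamily_pairwise_le_of_boxPlaqs hm W ha hN t hplaq r i 0)

/-! ## §2  The averaged field of a gauge copy: the plaquette letter of `M^n U` suffices -/

/-- **THE PLAQUETTE LETTER OF `M^n(U^w)` IS THAT OF `M^n U`** on any plaquette set ([3] (11) iterated: `M^n(U^w) = (M^n U)^{w^{(n)}}`, and `dist1` of a plaquette variable is conjugation
invariant). [cite: Balaban1985Averaging, (11) p.19; Balaban1987RG1, (0.5)–(0.7) p.253] -/
theorem plaqSmallOn_iter_gaugeAct_of_plaqSmallOn_iter {K n : ℕ} (hn : n ≤ (F.P K).m + (F.P K).K) (U : GaugeField (F.P K) 0 (SU N)) (w : GaugeTransf (F.P K) 0 (SU N))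
    {S : Set (Plaq (F.P K) n)} {a : ℝ} (hplaq : PlaqSmallOn S a (Averaging.iter (avOfRecord F N K) n U)) :
    PlaqSmallOn S a (Averaging.iter (avOfRecord F N K) n (gaugeAct w U)) := by
  intro p hp
  rw [iter_gaugeAct (avOfRecord F N K) w n hn U, dist1_plaqHol_gaugeAct]
  exact hplaq p hp

/-- ★★★ **THE RADIAL TREE-TRANSPORTER DEFECT OF THE `symCd`-AXIAL AVERAGED FIELD `M^n(U^w)` FROM THE BOX PLAQUETTE LETTER OF `M^n U`**: if `M^n(U^w)` is `symCd`-axial (`n + 1 ≤ m_F + K`,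
`L < sitesPerDir n`), the plaquettes of `M^n U` on the box of the block `castSite t` are within `a ≥ 0` of `1` with `2σ′(a) ≤ 1∕100`, `2σ′(a) < δ_N`, then at every block site
`x = blockSite (castSite t) r ≠ emb (castSite t)`: `dist1 (M^n(U^w)(Γ_{y,x})) ≤ 4·(2σ′(a))` — the torus-side `δ₁(n)` of ✓p754021 before the cover transcription.
[cite: Balaban1987RG1, (0.3)–(0.4) pp.252–253, (0.11) p.253; Balaban1985Averaging, (11) p.19; Balaban1985Variational, (147)–(154) pp.301–302] -/
theorem dist1_radialHol_iter_gaugeAct_le_of_boxPlaqs {K n : ℕ} (hn : n + 1 ≤ (F.P K).m + (F.P K).K) (U : GaugeField (F.P K) 0 (SU N)) (w : GaugeTransf (F.P K) 0 (SU N))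
    (hax : AxialGauge (symCd F N K n) (Averaging.iter (avOfRecord F N K) n (gaugeAct w U))) {a : ℝ} (ha : 0 ≤ a) (hN : (F.P K).L < (F.P K).sitesPerDir n)
    (t : Fin (F.P K).d → ℤ)
    (hplaq : PlaqSmallOn (boxPlaqs (fun i => ((F.P K).L : ℤ) * t i) (fun i => ((F.P K).L : ℤ) * t i + (((F.P K).L : ℤ) - 1))) a (Averaging.iter (avOfRecord F N K) n U))
    (h100 : 2 * ((((F.P K).d * (((F.P K).L - 1) / 2) : ℕ) : ℝ) * (((((F.P K).d - 1 : ℕ) : ℝ) * (((F.P K).L - 1 : ℕ) : ℝ)) * a)) ≤ 1 / 100)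
    (hguard : 2 * ((((F.P K).d * (((F.P K).L - 1) / 2) : ℕ) : ℝ) * (((((F.P K).d - 1 : ℕ) : ℝ) * (((F.P K).L - 1 : ℕ) : ℝ)) * a)) < (FederbushMean.federbushSU (n := Fin N)).δ)
    (r : Fin (F.P K).d → Fin (F.P K).L) (hxy : Site.blockSite (castSite t : Site (F.P K) (n + 1)) r ≠ emb (castSite t : Site (F.P K) (n + 1))) :
    dist1 (radialHol (Averaging.iter (avOfRecord F N K) n (gaugeAct w U)) (castSite t) (Site.blockSite (castSite t) r)) ≤
      4 * (2 * ((((F.P K).d * (((F.P K).L - 1) / 2) : ℕ) : ℝ) * (((((F.P K).d - 1 : ℕ) : ℝ) * (((F.P K).L - 1 : ℕ) : ℝ)) * a))) :=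
  dist1_radialHol_le_of_axialGauge_symCd_of_boxPlaqs hn _ hax ha hN t
    (plaqSmallOn_iter_gaugeAct_of_plaqSmallOn_iter (Nat.le_of_succ_le hn) U w hplaq) h100 hguard r hxy

/-! ## §3  From the fine plaquettes under the block -/

/-- ★★★ **THE RADIAL TREE-TRANSPORTER DEFECT OF `M^n(U^w)` FROM THE FINE PLAQUETTES UNDER THE BLOCK** (127's budgets verbatim): if the fine plaquettes of `U` on a set `S₀` containing the
fine box under the level-`(n+1)` block `castSite t` are within `a₀` of `1`, the budgets `6400ℓ²L^{n+1}·((d−1)(L^{n+1}−1)a₀) ≤ 1`, `30ℓ²L^{n+1}·(…) < δ_N` hold, `a > 120ℓLⁿ·((d−1)(L^{n+1}−1)a₀)`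
with `2σ′(a) ≤ 1∕100`, `2σ′(a) < δ_N`, and `M^n(U^w)` is `symCd`-axial, then `dist1 (M^n(U^w)(Γ_{y,x})) ≤ 4·(2σ′(a))` at every block site `x ≠ emb y` of `y = castSite t` — GEOMETRIC in `n`
when `a₀ = ε_r·η_r²` is the def of record's fine letter of the tower's region (`a ≈ 120(d−1)ℓL·ε_r·L^{2(n−r)}`).
[cite: Balaban1987RG1, (0.3)–(0.4) pp.252–253, (0.11) p.253; Balaban1985Averaging, (11) p.19, Prop. 1 p.20; Balaban1985Variational, (147)–(154) pp.301–302; Balaban1985RegularSpaces, Lemma 1 p.79] -/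
theorem dist1_radialHol_iter_gaugeAct_le_of_fineBoxPlaqs {K n : ℕ} (hn : n + 1 ≤ (F.P K).m + (F.P K).K) (U : GaugeField (F.P K) 0 (SU N)) (w : GaugeTransf (F.P K) 0 (SU N))
    (hax : AxialGauge (symCd F N K n) (Averaging.iter (avOfRecord F N K) n (gaugeAct w U))) (hN : (F.P K).L < (F.P K).sitesPerDir n) (t : Fin (F.P K).d → ℤ)
    {a₀ : ℝ} (ha₀ : 0 ≤ a₀) {S₀ : Set (Plaq (F.P K) 0)}
    (hS₀ : boxPlaqs (fun i => ((F.P K).L : ℤ) ^ (n + 1) * t i) (fun i => ((F.P K).L : ℤ) ^ (n + 1) * t i + (((F.P K).L : ℤ) ^ (n + 1) - 1)) ⊆ S₀)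
    (hU : PlaqSmallOn S₀ a₀ U)
    (hbud : 6400 * ((((F.P K).d + 2) * (F.P K).L : ℕ) : ℝ) ^ 2 * ((F.P K).L : ℝ) ^ (n + 1) * (((((F.P K).d - 1 : ℕ) : ℝ)) * ((((F.P K).L ^ (n + 1) - 1 : ℕ) : ℝ)) * a₀) ≤ 1)
    (hgd : 30 * ((((F.P K).d + 2) * (F.P K).L : ℕ) : ℝ) ^ 2 * ((F.P K).L : ℝ) ^ (n + 1) * (((((F.P K).d - 1 : ℕ) : ℝ)) * ((((F.P K).L ^ (n + 1) - 1 : ℕ) : ℝ)) * a₀) < deltaSU (Fin N))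
    {a : ℝ} (ha : 0 ≤ a) (haa : 120 * ((((F.P K).d + 2) * (F.P K).L : ℕ) : ℝ) * ((F.P K).L : ℝ) ^ n * (((((F.P K).d - 1 : ℕ) : ℝ)) * ((((F.P K).L ^ (n + 1) - 1 : ℕ) : ℝ)) * a₀) < a)
    (h100 : 2 * ((((F.P K).d * (((F.P K).L - 1) / 2) : ℕ) : ℝ) * (((((F.P K).d - 1 : ℕ) : ℝ) * (((F.P K).L - 1 : ℕ) : ℝ)) * a)) ≤ 1 / 100)
    (hguard : 2 * ((((F.P K).d * (((F.P K).L - 1) / 2) : ℕ) : ℝ) * (((((F.P K).d - 1 : ℕ) : ℝ) * (((F.P K).L - 1 : ℕ) : ℝ)) * a)) < (FederbushMean.federbushSU (n := Fin N)).δ)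
    (r : Fin (F.P K).d → Fin (F.P K).L) (hxy : Site.blockSite (castSite t : Site (F.P K) (n + 1)) r ≠ emb (castSite t : Site (F.P K) (n + 1))) :
    dist1 (radialHol (Averaging.iter (avOfRecord F N K) n (gaugeAct w U)) (castSite t) (Site.blockSite (castSite t) r)) ≤
      4 * (2 * ((((F.P K).d * (((F.P K).L - 1) / 2) : ℕ) : ℝ) * (((((F.P K).d - 1 : ℕ) : ℝ) * (((F.P K).L - 1 : ℕ) : ℝ)) * a))) :=
  dist1_radialHol_iter_gaugeAct_le_of_boxPlaqs hn U w hax ha hN t (plaqSmallOn_iter_block_of_fineBoxPlaqs hn U ha₀ t hS₀ hU hbud hgd haa) h100 hguard r hxy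

end Summit.QuantumFields.YangMills.BalabanUVNodes.N07SymAxialRadialDefectOfBoxPlaquettes

end
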